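import Literature.AlgebraicGeometry.Morphisms.CechH2ResolutionDimTwo
import Summits.ResolutionOfSingularities.ResolutionOfSingularities.Theorems.HomologicalConductorNoZenoGWH2Instance
import HarnessLib

/-!
# Crux `NoZenoR` (stmt-ResolutionOfSingularities-19943) — DR-F53 (δ): the door instance `GWH2ResolutionDim2`
# from local Serre vanishing on blow-up charts and coherent extension of Čech cocycles

OURS (cell res-hironaka, crux chain W4.4, route (δ) «domination + divisorial twist», booked by director-resolution g7
2026-08-28T09:12:49Z; route lead res-inputs-p-9b). Counted 0; AI-written, weaker than expert review; nothing here is a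
statement of the manuscript under review (Hironaka 2017).

The W4.4 door instance `NoZeno.GWH2ResolutionDim2` (`HomologicalConductorNoZenoGWH2Instance.lean` §R3b: `Ȟ²(𝒰, M) = 0` for every
affine-localizing `M` and every finite affine open cover `𝒰` of a resolution `π : X → Spec A` of a two-dimensional Noetherian
local domain) is reduced here — by ONE application of the fact-free Literature theorem
`Literature.AlgebraicGeometry.Morphisms.subsingleton_cechMH2_of_isResolution_of_localVanishing_of_cocycleExtension`
(`Morphisms/CechH2ResolutionDimTwo.lean`: Stacks 081T domination, divisorial/codimension-two split of the centre, the projective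
`Ȟ²`-vanishing on the dominating blow-up, the torsion-free `𝓙ⁿ`-twist and the degree-two Čech transfers — NO theorem on formal
functions, NO Lipman (27.2)) — to two spelled-out statements about ALL blow-up charts / Noetherian schemes at universe `0`:

* `hLV` — local Serre vanishing: `H¹(r⁻¹U, 𝓙ⁿG) = 0` for `n ≫ 0`, for a blow-up `r : S′ → X` along `J`, an affine `U ⊆ X` and a
  coherent `𝓙`-torsion-free `G` (Hartshorne III Thm. 5.2 (b) on `r⁻¹U = Bl_{J(U)} U ↪ 𝐏^m`; tree Serre A/B `Modules/SerreTheoremA`,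
  `Modules/SerreVanishingTwist`; to be supplied as `Resolution.exists_affine_family_cechMZ1_idealMul_pow_le_of_torsionFree`);
* `hext` — a Čech `2`-cocycle of an affine-localizing module on a finite affine cover lies in a coherent submodule (EGA I 9.4.9;
  to be supplied by the module form of `Limits/IdealSheafExtension`).

* `gwH2ResolutionDim2_of_localVanishing_of_cocycleExtension` — **`hLV → hext → GWH2ResolutionDim2`**.

When both inputs are tree theorems, `theorem gwH2ResolutionDim2_holds : GWH2ResolutionDim2` is one line over this file.  Scope: the
REGULAR-`X` resolution door only; `GWH2ProperBirationalDim2` (Y merely integral) and the general named fact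
`GortzWedhorn2023_24_44_H2` STAY PRINT / untouched.  This file discharges NOTHING by itself; no summit statement is proved;
resolution of singularities in dimension ≥ 4 / characteristic p is NOT proved by anything here.
-/

-- single-problem summit: the doubled namespace component `ResolutionOfSingularities` is forced
set_option linter.dupNamespace false

open CategoryTheory CategoryTheory.Limits AlgebraicGeometry TopologicalSpace
open Literature.AlgebraicGeometry.Morphisms Literature.AlgebraicGeometry.Resolution
open Literature.AlgebraicGeometry.Modules

namespace Summit.ResolutionOfSingularities.ResolutionOfSingularities.Theorems.NoZeno

/-- **DR-F53 (δ): `GWH2ResolutionDim2` from local Serre vanishing on blow-up charts (`hLV`) and coherent extension of Čech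
`2`-cocycles (`hext`)** — both hypotheses quantified over all schemes at universe `0`, exactly as the Literature theorem
`subsingleton_cechMH2_of_isResolution_of_localVanishing_of_cocycleExtension` consumes them. [this work] -/
theorem gwH2ResolutionDim2_of_localVanishing_of_cocycleExtension
    (hLV : ∀ (A : Type) [CommRing A] [IsNoetherianRing A] (X : Scheme.{0}) [IsIntegral X] [IsNoetherian X]
      (S' : Scheme.{0}) [IsIntegral S'] [IsNoetherian S'] (fS : S' ⟶ Spec (.of A)) (r : S' ⟶ X)
      (J : X.IdealSheafData), IsBlowup r J → ∀ (U : X.Opens), IsAffineOpen U →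
      ∀ (G : S'.Modules), Coh G →
        (∀ (V : S'.Opens) (hV : IsAffineOpen V) (q : Γ(G, V)),
          (∀ a ∈ (J.comap r).ideal ⟨V, hV⟩, a • q = 0) → q = 0) →
        ∃ d₀ : ℕ, ∀ n, d₀ ≤ n → ∃ (κ : Type) (T : κ → S'.Opens),
          (∀ t, IsAffineOpen (T t)) ∧ ⨆ t, T t = r ⁻¹ᵁ U ∧
          cechMZ1 fS (idealMul G ((J.comap r) ^ n)) T ≤ cechMB1 fS (idealMul G ((J.comap r) ^ n)) T)
    (hext : ∀ (X : Scheme.{0}) [IsNoetherian X] (A : Type) [CommRing A] (f : X ⟶ Spec (.of A))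
      (ι : Type) [Finite ι] (U : ι → X.Opens), (∀ i, IsAffineOpen (U i)) →
      ∀ (M : X.Modules), IsAffineLocalizing M → ∀ z : CechMC2 f M U, z ∈ cechMZ2 f M U →
        ∃ (M' : X.Modules) (φ : M' ⟶ M) (z' : CechMC2 f M' U),
          Coh M' ∧ z' ∈ cechMZ2 f M' U ∧ cechMapC2 f φ U z' = z) :
    GWH2ResolutionDim2 := by
  intro A _ _ _ _ hA X _ _ π hπ M hM ι _ U hU hcov
  haveI : IsProper π := hπ.isProper
  haveI : IsNoetherian X := by
    haveI : CompactSpace X := QuasiCompact.compactSpace_of_compactSpace π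
    exact {}
  exact subsingleton_cechMH2_of_isResolution_of_localVanishing_of_cocycleExtension hA hπ
    (fun S' _ _ fS r J hr V hV G hG htf => hLV A X S' fS r J hr V hV G hG htf)
    (fun κ _ V hV N hN z hz => hext X A π κ V hV N hN z hz) hM U hU hcov


/-! ## §2 (APPENDED 2026-08-28, critic R55): the reduction OF RECORD, with the S8 oracle's binders
(`[X.IsSeparated]` in `hext`, = `Morphisms.exists_coh_cechMZ2_map_eq` of p-5b's S8 SIGNATURE 7d52f5e76dd467a2 at universe `0`).
The unprimed theorem above (stronger `hext`, no separatedness) is kept only because Theorems files are append-only; use the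
primed one. -/

/-- **DR-F53 (δ), reduction of record: `GWH2ResolutionDim2` from local Serre vanishing on blow-up charts (`hLV`) and coherent
extension of Čech `2`-cocycles on SEPARATED Noetherian schemes (`hext`)** — supersedes
`gwH2ResolutionDim2_of_localVanishing_of_cocycleExtension`: `hext` carries `[X.IsSeparated]` exactly as the S8 deliverable
`Morphisms.exists_coh_cechMZ2_map_eq` (a resolution `X → Spec A` is proper, hence `X` is separated, so the weaker oracle
suffices); `hLV` unchanged (= the frozen (LV-tf) binders of `Resolution.exists_affine_family_cechMZ1_idealMul_pow_le_of_torsionFree`).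
[this work] -/
theorem gwH2ResolutionDim2_of_localVanishing_of_cocycleExtension'
    (hLV : ∀ (A : Type) [CommRing A] [IsNoetherianRing A] (X : Scheme.{0}) [IsIntegral X] [IsNoetherian X]
      (S' : Scheme.{0}) [IsIntegral S'] [IsNoetherian S'] (fS : S' ⟶ Spec (.of A)) (r : S' ⟶ X)
      (J : X.IdealSheafData), IsBlowup r J → ∀ (U : X.Opens), IsAffineOpen U →
      ∀ (G : S'.Modules), Coh G →
        (∀ (V : S'.Opens) (hV : IsAffineOpen V) (q : Γ(G, V)),
          (∀ a ∈ (J.comap r).ideal ⟨V, hV⟩, a • q = 0) → q = 0) →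
        ∃ d₀ : ℕ, ∀ n, d₀ ≤ n → ∃ (κ : Type) (T : κ → S'.Opens),
          (∀ t, IsAffineOpen (T t)) ∧ ⨆ t, T t = r ⁻¹ᵁ U ∧
          cechMZ1 fS (idealMul G ((J.comap r) ^ n)) T ≤ cechMB1 fS (idealMul G ((J.comap r) ^ n)) T)
    (hext : ∀ (X : Scheme.{0}) [IsNoetherian X] [X.IsSeparated] (A : Type) [CommRing A]
      (f : X ⟶ Spec (.of A)) (ι : Type) [Finite ι] (U : ι → X.Opens), (∀ i, IsAffineOpen (U i)) →
      ∀ (M : X.Modules), IsAffineLocalizing M → ∀ z : CechMC2 f M U, z ∈ cechMZ2 f M U →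
        ∃ (M' : X.Modules) (φ : M' ⟶ M) (z' : CechMC2 f M' U),
          Coh M' ∧ z' ∈ cechMZ2 f M' U ∧ cechMapC2 f φ U z' = z) :
    GWH2ResolutionDim2 := by
  intro A _ _ _ _ hA X _ _ π hπ M hM ι _ U hU hcov
  haveI : IsProper π := hπ.isProper
  -- a proper `X → Spec A` is separated over the (separated) affine base, so `X` is separated
  haveI : X.IsSeparated := ⟨by rw [← Limits.terminal.comp_from π]; infer_instance⟩
  haveI : IsNoetherian X := by
    haveI : CompactSpace X := QuasiCompact.compactSpace_of_compactSpace π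
    exact {}
  exact subsingleton_cechMH2_of_isResolution_of_localVanishing_of_cocycleExtension hA hπ
    (fun S' _ _ fS r J hr V hV G hG htf => hLV A X S' fS r J hr V hV G hG htf)
    (fun κ _ V hV N hN z hz => hext X A π κ V hV N hN z hz) hM U hU hcov

end Summit.ResolutionOfSingularities.ResolutionOfSingularities.Theorems.NoZeno
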